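import Literature.Barriers.CriticalPhenomena.KozmaNachmiasLemma11
import HarnessLib

/-!
# Kozma–Nachmias 2011, Corollary 3.2 PROVED: connections to `∂Q_r` inside `(x + Q_s) ∩ Q_r`

Barrier catalogue `Literature/Barriers/CriticalPhenomena/` (D-0021), programme for Theorem 2 of
Kozma–Nachmias 2011. Corollary 3.2 (p. 388): "Let `r > s > 0` and let `x ∈ ℤ^d` such that
`(x + Q_s) ∩ ∂Q_r ≠ ∅`. Then for any `y ∈ B := (x + Q_s) ∩ Q_r`, `P(y ↔ ∂Q_r in B) ≥ e^{-c log² s}`."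
It is the input of the exploration argument of §4.4 (Lemma 4.5). PROVED here for the
nearest-neighbour lattice `ℤ^d` (`d ≥ 2`, every `p ≥ p_c`, all `r` and `s ≥ 1`):
`KozmaNachmias2011_cor32`, with constants `c, C > 0` depending on `d` and `p` only.

Printed proof: "`B` is a box … Denote by `ℓ` its shortest edge so that `ℓ ≤ 2s`. It is now easy to
see that one can find a cube `z + Q_{ℓ/2} ⊂ B` containing both `y` and at least one point from `∂Q_r`
… `P(y ↔ ∂Q_r in B) ≥ P(y ↔ z in B and z ↔ ∂Q_r in B) ≥ [FKG] … ≥ [Lemma 1.1] c exp(-C log² s)`."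
The formalisation makes the "easy to see" explicit (`exists_cube`): the edge of `B` in direction `i`
is `[max(x_i - s, -r), min(x_i + s, r)]`, an edge shorter than `2s` is cut by a face of `Q_r`, so the
cube is aligned to that face in the direction `i₁` of the shortest edge (if all edges have length `2s`,
`B = x + Q_s ⊆ Q_r` and the cube is `B` itself); on the integer lattice the cube `z + Q_{⌊ℓ/2⌋}` may
miss `y` by one lattice step in direction `i₁` (when `ℓ` is odd), which costs one open edge (a factor
`p`). The two connections inside the cube come from Lemma 1.1 (`KozmaNachmias2011_lemma11`, valid for
all points of a cube) and Harris–FKG (`real_openConnIn_two_points_ge`).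

## References

* G. Kozma, A. Nachmias, J. Amer. Math. Soc. 24 (2011) 375–409: Cor. 3.2 (p. 388), Lemma 4.5.
-/

noncomputable section

namespace Literature.Barriers.CriticalPhenomena

open _root_.MeasureTheory Finset Literature.Probability.LatticeModels Literature.Probability.Percolation
  Literature.Probability.Percolation.DCT16
open scoped Literature.Probability.LatticeModels Literature.Probability.Percolation

variable {d : ℕ}

/-! ### Two points of a cube -/

section TwoPoints

variable (p : unitInterval)

/-- **Two points of a cube are connected inside any set containing the cube** with probability at
least `(c e^{-C log² h})²`, if `P_p(0 ↔ u in Q_h) ≥ c e^{-C log² h}` for all `u ∈ Q_h` (Lemma 1.1):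
both points are joined to the centre inside the cube (translation invariance), and the two increasing
events are positively correlated (Harris–FKG). (Kozma–Nachmias 2011, proof of Cor. 3.2:
"`P(y ↔ z in B, z ↔ ∂Q_r in B) ≥ P(y ↔ z) P(z ↔ ∂Q_r)` by FKG … by Lemma 1.1".)
[cite: KozmaNachmias2011, Cor. 3.2 (proof, p. 388)] -/
theorem real_openConnIn_two_points_ge {c₁ C₁ : ℝ} (hc₁0 : 0 ≤ c₁) (hc₁1 : c₁ ≤ 1)
    (h11 : ∀ r : ℕ, 1 ≤ r → ∀ u ∈ box d r, c₁ * Real.exp (-C₁ * Real.log r ^ 2) ≤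
      (bondPercolation (zdGraph d) p).real (openConnIn (↑(box d r) : Set (Site d)) 0 u))
    {S : Set (Site d)} {z a b : Site d} {h : ℕ}
    (hK : (zdShiftIso z) '' (↑(box d h) : Set (Site d)) ⊆ S) (ha : a - z ∈ box d h)
    (hb : b - z ∈ box d h) :
    (c₁ * Real.exp (-C₁ * Real.log h ^ 2)) ^ 2 ≤
      (bondPercolation (zdGraph d) p).real (openConnIn S a b) := by
  rcases Nat.eq_zero_or_pos h with rfl | hpos
  · -- degenerate cube: `a = b = z`
    have ha0 : a = z := by
      funext i
      have := (mem_box.1 ha) i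
      simp only [Pi.sub_apply, Nat.cast_zero, neg_zero] at this
      omega
    have hb0 : b = z := by
      funext i
      have := (mem_box.1 hb) i
      simp only [Pi.sub_apply, Nat.cast_zero, neg_zero] at this
      omega
    rw [ha0, hb0]
    have hzS : z ∈ S := hK ⟨0, Finset.mem_coe.2 (zero_mem_box d 0), by simp⟩
    have huniv : (openConnIn S z z : Set (BondConfig (Site d))) = Set.univ :=
      Set.eq_univ_of_forall fun ω => mem_openConnIn_rfl hzS ω
    rw [huniv, probReal_univ, Nat.cast_zero, Real.log_zero]
    simp only [ne_eq, OfNat.ofNat_ne_zero, not_false_eq_true, zero_pow, mul_zero, Real.exp_zero,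
      mul_one]
    nlinarith
  -- the two events
  set A : Set (BondConfig (Site d)) :=
    openConnIn ((zdShiftIso z) '' (↑(box d h) : Set (Site d))) z a with hA
  set B : Set (BondConfig (Site d)) :=
    openConnIn ((zdShiftIso z) '' (↑(box d h) : Set (Site d))) z b with hB
  have hPA : c₁ * Real.exp (-C₁ * Real.log h ^ 2) ≤ (bondPercolation (zdGraph d) p).real A := by
    have := real_openConnIn_shift_box p z (a - z) h
    rw [sub_add_cancel] at this
    rw [hA, this]
    exact h11 h hpos (a - z) ha
  have hPB : c₁ * Real.exp (-C₁ * Real.log h ^ 2) ≤ (bondPercolation (zdGraph d) p).real B := by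
    have := real_openConnIn_shift_box p z (b - z) h
    rw [sub_add_cancel] at this
    rw [hB, this]
    exact h11 h hpos (b - z) hb
  have hAB : (bondPercolation (zdGraph d) p).real A * (bondPercolation (zdGraph d) p).real B ≤
      (bondPercolation (zdGraph d) p).real (A ∩ B) :=
    harris_fkg_holds (zdGraph d) p (isUpperSet_openConnIn _ _ _) (isUpperSet_openConnIn _ _ _)
      (by rw [hA, zdShiftIso_image_box]; exact measurableSet_openConnIn _ _ _)
      (by rw [hB, zdShiftIso_image_box]; exact measurableSet_openConnIn _ _ _)
  have hsub : A ∩ B ⊆ openConnIn S a b := by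
    rintro ω ⟨hωA, hωB⟩
    exact mem_openConnIn_of_pathIn
      ((((pathIn_of_mem_openConnIn hωA).symm).trans (pathIn_of_mem_openConnIn hωB)).mono hK)
  have h0 : 0 ≤ c₁ * Real.exp (-C₁ * Real.log h ^ 2) := by positivity
  calc (c₁ * Real.exp (-C₁ * Real.log h ^ 2)) ^ 2
      = (c₁ * Real.exp (-C₁ * Real.log h ^ 2)) * (c₁ * Real.exp (-C₁ * Real.log h ^ 2)) := sq _
    _ ≤ (bondPercolation (zdGraph d) p).real A * (bondPercolation (zdGraph d) p).real B :=
        mul_le_mul hPA hPB h0 measureReal_nonneg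
    _ ≤ _ := hAB.trans (measureReal_mono hsub)

end TwoPoints

/-! ### The cube inside `B = (x + Q_s) ∩ Q_r` -/

section Cube

/-- One coordinate: clamping `v ∈ [lo, hi]` into `[lo + h, hi - h]` (`hi - lo ≥ 2h`) moves it by
at most `h`. [folklore] -/
theorem abs_sub_clamp_le {lo hi v : ℤ} {h : ℕ} (hlen : lo + 2 * (h : ℤ) ≤ hi) (hv : lo ≤ v ∧ v ≤ hi) :
    |v - max (lo + h) (min v (hi - h))| ≤ h ∧
      lo + h ≤ max (lo + h) (min v (hi - h)) ∧ max (lo + h) (min v (hi - h)) ≤ hi - h := by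
  refine ⟨?_, le_max_left _ _, ?_⟩
  · rw [abs_le]
    constructor
    · rcases le_total (lo + h) (min v (hi - h)) with h1 | h1
      · rw [max_eq_right h1]
        have := min_le_left v (hi - h)
        linarith
      · rw [max_eq_left h1]
        have := min_le_min_left v (le_refl (hi - (h : ℤ)))
        omega
    · omega
  · exact max_le (by omega) (min_le_right _ _)

/-- **The cube** ("It is now easy to see that one can find a cube `z + Q_{ℓ/2} ⊂ B` containing both
`y` and at least one point from `∂Q_r`; just construct `z` coordinate by coordinate", p. 388; on the
integer lattice, up to one lattice step from `y`): for `s ≥ 1`, `x` with `(x + Q_s) ∩ ∂Q_r ≠ ∅` and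
`y ∈ B = (x + Q_s) ∩ Q_r`, there are `h ≤ s`, a cube `z + Q_h ⊆ B`, a point `w ∈ ∂Q_r` of the cube
and a point `y'` of the cube with `y' = y` or `y' ∼ y`, `y' ∈ B`.
[cite: KozmaNachmias2011, Cor. 3.2 (proof, p. 388)] -/
theorem exists_cube (hd : 1 ≤ d) {r s : ℕ} {x y : Site d} (hw : ∃ w ∈ sphere d r, w - x ∈ box d s)
    (hy : y ∈ box d r) (hyx : y - x ∈ box d s) :
    ∃ (h : ℕ) (z w y' : Site d), h ≤ s ∧
      (∀ u : Site d, u - z ∈ box d h → u ∈ box d r ∧ u - x ∈ box d s) ∧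
      w ∈ sphere d r ∧ w - z ∈ box d h ∧ y' - z ∈ box d h ∧
      (y' = y ∨ (zdGraph d).Adj y y') ∧ y' ∈ box d r ∧ y' - x ∈ box d s := by
  classical
  -- the edges of `B`
  set lo : Fin d → ℤ := fun i => max (x i - s) (-(r : ℤ)) with hlo
  set hi : Fin d → ℤ := fun i => min (x i + s) r with hhi
  have hyB : ∀ i, lo i ≤ y i ∧ y i ≤ hi i := by
    intro i
    have h1 := (mem_box.1 hy) i
    have h2 := (mem_box.1 hyx) i
    simp only [hlo, hhi, Pi.sub_apply] at h2 ⊢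
    constructor
    · exact max_le (by omega) (by omega)
    · exact le_min (by omega) (by omega)
  -- membership in `B` coordinatewise
  have hmemB : ∀ u : Site d, (∀ i, lo i ≤ u i ∧ u i ≤ hi i) → u ∈ box d r ∧ u - x ∈ box d s := by
    intro u hu
    constructor
    · rw [mem_box]; intro i
      have := hu i
      simp only [hlo, hhi, max_le_iff, le_min_iff] at this
      omega
    · rw [mem_box]; intro i
      have := hu i
      simp only [hlo, hhi, max_le_iff, le_min_iff] at this
      simp only [Pi.sub_apply]
      omega
  have hedge : ∀ i, lo i + 0 ≤ hi i := fun i => by have := hyB i; omega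
  have hedge2s : ∀ i, hi i - lo i ≤ 2 * s := by
    intro i
    simp only [hlo, hhi]
    have h1 := min_le_left (x i + (s : ℤ)) r
    have h2 := le_max_left (x i - (s : ℤ)) (-(r : ℤ))
    linarith
  -- the shortest edge
  have huniv : (Finset.univ : Finset (Fin d)).Nonempty := ⟨⟨0, by omega⟩, Finset.mem_univ _⟩
  obtain ⟨i₁, -, hi₁⟩ := Finset.exists_min_image Finset.univ (fun i => hi i - lo i) huniv
  have hmin : ∀ i, hi i₁ - lo i₁ ≤ hi i - lo i := fun i => hi₁ i (Finset.mem_univ i)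
  rcases lt_or_ge (hi i₁ - lo i₁) (2 * s) with hcut | hfull
  · -- an edge shorter than `2s`: it is cut by a face of `Q_r` in direction `i₁`
    set h : ℕ := (hi i₁ - lo i₁).toNat / 2 with hh
    have hℓ : ((hi i₁ - lo i₁).toNat : ℤ) = hi i₁ - lo i₁ := Int.toNat_of_nonneg (by have := hedge i₁; omega)
    have h2h : 2 * (h : ℤ) ≤ hi i₁ - lo i₁ ∧ hi i₁ - lo i₁ ≤ 2 * h + 1 := by
      have : 2 * h ≤ (hi i₁ - lo i₁).toNat ∧ (hi i₁ - lo i₁).toNat ≤ 2 * h + 1 := by omega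
      omega
    have hhs : h ≤ s := by omega
    have hlen : ∀ i, lo i + 2 * (h : ℤ) ≤ hi i := fun i => by have := hmin i; omega
    -- the clamped coordinates
    set cl : Fin d → ℤ := fun i => max (lo i + h) (min (y i) (hi i - h)) with hcl
    have hclP : ∀ i, |y i - cl i| ≤ h ∧ lo i + h ≤ cl i ∧ cl i ≤ hi i - h :=
      fun i => abs_sub_clamp_le (hlen i) (hyB i)
    -- which face is cut
    have hface : hi i₁ = r ∨ lo i₁ = -(r : ℤ) := by
      by_contra hcon
      push Not at hcon
      have h1 : hi i₁ = x i₁ + s := by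
        simp only [hhi] at hcon ⊢
        rcases min_choice (x i₁ + (s : ℤ)) r with h | h
        · exact h
        · exact absurd h hcon.1
      have h2 : lo i₁ = x i₁ - s := by
        simp only [hlo] at hcon ⊢
        rcases max_choice (x i₁ - (s : ℤ)) (-(r : ℤ)) with h | h
        · exact h
        · exact absurd h hcon.2
      omega
    rcases hface with htop | hbot
    · -- aligned to the face `u_{i₁} = r`
      set z : Site d := Function.update cl i₁ (r - h) with hz
      set w : Site d := Function.update cl i₁ r with hwdef
      set y' : Site d := if y i₁ < r - 2 * h then y + Pi.single i₁ 1 else y with hy'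
      have hzi₁ : z i₁ = r - h := by rw [hz, Function.update_self]
      have hzi : ∀ i, i ≠ i₁ → z i = cl i := fun i hi => by rw [hz, Function.update_of_ne hi]
      have hcube : ∀ u : Site d, u - z ∈ box d h → ∀ i, lo i ≤ u i ∧ u i ≤ hi i := by
        intro u hu i
        have hui := (mem_box.1 hu) i
        simp only [Pi.sub_apply] at hui
        rcases eq_or_ne i i₁ with rfl | hne
        · rw [hzi₁] at hui; omega
        · rw [hzi i hne] at hui
          have := hclP i
          omega
      refine ⟨h, z, w, y', hhs, fun u hu => hmemB u (hcube u hu), ?_, ?_, ?_, ?_, ?_⟩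
      · -- `w ∈ ∂Q_r`
        have hwz : w - z ∈ box d h := by
          rw [mem_box]; intro i
          simp only [Pi.sub_apply]
          rcases eq_or_ne i i₁ with rfl | hne
          · rw [hwdef, Function.update_self, hzi₁]; omega
          · rw [hwdef, Function.update_of_ne hne, hzi i hne]; omega
        have hwbox : w ∈ box d r := (hmemB w (hcube w hwz)).1
        rw [mem_sphere]
        refine le_antisymm (mem_box_iff_supNorm_le.1 hwbox) ?_
        have := Site.natAbs_le_supNorm w i₁
        have hwi₁ : w i₁ = r := by rw [hwdef, Function.update_self]
        rw [hwi₁] at this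
        omega
      · rw [mem_box]; intro i
        simp only [Pi.sub_apply]
        rcases eq_or_ne i i₁ with rfl | hne
        · rw [hwdef, Function.update_self, hzi₁]; omega
        · rw [hwdef, Function.update_of_ne hne, hzi i hne]; omega
      · -- `y'` in the cube
        rw [mem_box]; intro i
        simp only [Pi.sub_apply]
        have hyi := hyB i
        rcases eq_or_ne i i₁ with rfl | hne
        · rw [hzi₁, hy']
          have : lo i = r - (hi i - lo i) := by omega
          split_ifs with hlt
          · simp only [Pi.add_apply, Pi.single_eq_same]; omega
          · omega
        · rw [hzi i hne, hy']
          have := (hclP i).1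
          rw [abs_le] at this
          split_ifs with hlt
          · simp only [Pi.add_apply, Pi.single_eq_of_ne hne, add_zero]; omega
          · omega
      · -- `y' = y` or `y ∼ y'`
        rw [hy']
        split_ifs with hlt
        · right
          rw [zdGraph_adj_iff]
          exact ⟨i₁, Or.inl rfl⟩
        · left; rfl
      · -- `y' ∈ B`
        refine hmemB y' fun i => ?_
        have hyi := hyB i
        rw [hy']
        rcases eq_or_ne i i₁ with rfl | hne
        · split_ifs with hlt
          · simp only [Pi.add_apply, Pi.single_eq_same]; omega
          · exact hyi
        · split_ifs with hlt
          · simp only [Pi.add_apply, Pi.single_eq_of_ne hne, add_zero]; exact hyi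
          · exact hyi
    · -- aligned to the face `u_{i₁} = -r`
      set z : Site d := Function.update cl i₁ (-(r : ℤ) + h) with hz
      set w : Site d := Function.update cl i₁ (-(r : ℤ)) with hwdef
      set y' : Site d := if -(r : ℤ) + 2 * h < y i₁ then y - Pi.single i₁ 1 else y with hy'
      have hzi₁ : z i₁ = -(r : ℤ) + h := by rw [hz, Function.update_self]
      have hzi : ∀ i, i ≠ i₁ → z i = cl i := fun i hi => by rw [hz, Function.update_of_ne hi]
      have hcube : ∀ u : Site d, u - z ∈ box d h → ∀ i, lo i ≤ u i ∧ u i ≤ hi i := by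
        intro u hu i
        have hui := (mem_box.1 hu) i
        simp only [Pi.sub_apply] at hui
        rcases eq_or_ne i i₁ with rfl | hne
        · rw [hzi₁] at hui; omega
        · rw [hzi i hne] at hui
          have := hclP i
          omega
      refine ⟨h, z, w, y', hhs, fun u hu => hmemB u (hcube u hu), ?_, ?_, ?_, ?_, ?_⟩
      · have hwz : w - z ∈ box d h := by
          rw [mem_box]; intro i
          simp only [Pi.sub_apply]
          rcases eq_or_ne i i₁ with rfl | hne
          · rw [hwdef, Function.update_self, hzi₁]; omega
          · rw [hwdef, Function.update_of_ne hne, hzi i hne]; omega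
        have hwbox : w ∈ box d r := (hmemB w (hcube w hwz)).1
        rw [mem_sphere]
        refine le_antisymm (mem_box_iff_supNorm_le.1 hwbox) ?_
        have := Site.natAbs_le_supNorm w i₁
        have hwi₁ : w i₁ = -(r : ℤ) := by rw [hwdef, Function.update_self]
        rw [hwi₁] at this
        omega
      · rw [mem_box]; intro i
        simp only [Pi.sub_apply]
        rcases eq_or_ne i i₁ with rfl | hne
        · rw [hwdef, Function.update_self, hzi₁]; omega
        · rw [hwdef, Function.update_of_ne hne, hzi i hne]; omega
      · rw [mem_box]; intro i
        simp only [Pi.sub_apply]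
        have hyi := hyB i
        rcases eq_or_ne i i₁ with rfl | hne
        · rw [hzi₁, hy']
          have : hi i = lo i + (hi i - lo i) := by omega
          split_ifs with hlt
          · simp only [Pi.sub_apply, Pi.single_eq_same]; omega
          · omega
        · rw [hzi i hne, hy']
          have := (hclP i).1
          rw [abs_le] at this
          split_ifs with hlt
          · simp only [Pi.sub_apply, Pi.single_eq_of_ne hne, sub_zero]; omega
          · omega
      · rw [hy']
        split_ifs with hlt
        · right
          rw [zdGraph_adj_iff]
          exact ⟨i₁, Or.inr (by simp)⟩
        · left; rfl
      · refine hmemB y' fun i => ?_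
        have hyi := hyB i
        rw [hy']
        rcases eq_or_ne i i₁ with rfl | hne
        · split_ifs with hlt
          · simp only [Pi.sub_apply, Pi.single_eq_same]; omega
          · exact hyi
        · split_ifs with hlt
          · simp only [Pi.sub_apply, Pi.single_eq_of_ne hne, sub_zero]; exact hyi
          · exact hyi
  · -- all edges have length `2s`: `B = x + Q_s ⊆ Q_r`, the cube is `B`
    have hall : ∀ i, lo i = x i - s ∧ hi i = x i + s := by
      intro i
      have h1 := hmin i
      have h2 := hedge2s i
      simp only [hlo, hhi] at h1 h2 ⊢
      have h3 := min_le_left (x i + (s : ℤ)) r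
      have h4 := le_max_left (x i - (s : ℤ)) (-(r : ℤ))
      have h5 := min_le_left (x i₁ + (s : ℤ)) r
      have h6 := le_max_left (x i₁ - (s : ℤ)) (-(r : ℤ))
      constructor <;> linarith
    obtain ⟨w₀, hw₀, hw₀x⟩ := hw
    have hM : Site.supNorm w₀ = r := mem_sphere.1 hw₀
    obtain ⟨i₀, hi₀⟩ := Site.exists_natAbs_eq_supNorm huniv w₀
    rw [hM] at hi₀
    have hw₀i := (mem_box.1 hw₀x) i₀
    simp only [Pi.sub_apply] at hw₀i
    have hcube : ∀ u : Site d, u - x ∈ box d s → ∀ i, lo i ≤ u i ∧ u i ≤ hi i := by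
      intro u hu i
      have := (mem_box.1 hu) i
      simp only [Pi.sub_apply] at this
      have := hall i
      omega
    -- `w = x ± s e_{i₀}`
    set σ : ℤ := if 0 ≤ w₀ i₀ then 1 else -1 with hσ
    set w : Site d := x + Pi.single i₀ (σ * s) with hwdef
    have hwx : w - x ∈ box d s := by
      rw [mem_box]; intro i
      rw [hwdef, add_sub_cancel_left]
      rcases eq_or_ne i i₀ with rfl | hne
      · simp only [Pi.single_eq_same, hσ]; split_ifs <;> simp
      · simp [Pi.single_eq_of_ne hne]
    refine ⟨s, x, w, y, le_rfl, fun u hu => hmemB u (hcube u hu), ?_, hwx, hyx, Or.inl rfl, hy, hyx⟩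
    have hwbox : w ∈ box d r := (hmemB w (hcube w hwx)).1
    rw [mem_sphere]
    refine le_antisymm (mem_box_iff_supNorm_le.1 hwbox) ?_
    have := Site.natAbs_le_supNorm w i₀
    have hwi₀ : w i₀ = x i₀ + σ * s := by rw [hwdef]; simp
    rw [hwi₀] at this
    have hli₀ := hall i₀
    rw [hσ] at this
    split_ifs at this with h0 <;> omega

end Cube

/-! ### Corollary 3.2 -/

section Cor32

variable (p : unitInterval)

/-- One open edge followed by a connection: `P(y ↔ w in S) ≥ p · P(y' ↔ w in S)` for `y ∼ y'` in a
finite `S`. [folklore] -/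
theorem real_openConnIn_ge_mul_of_adj (S : Finset (Site d)) {y y' w : Site d} (hy : y ∈ S) (hy' : y' ∈ S)
    (hadj : (zdGraph d).Adj y y') :
    (p : ℝ) * (bondPercolation (zdGraph d) p).real (openConnIn (↑S : Set (Site d)) y' w) ≤
      (bondPercolation (zdGraph d) p).real (openConnIn (↑S : Set (Site d)) y w) := by
  have hE : s(y, y') ∈ (zdGraph d).edgeSet := hadj
  rw [← bondPercolation_cylinder (zdGraph d) p hE]
  refine (harris_fkg_holds (zdGraph d) p (fun ω ω' hle (h : s(y, y') ∈ ω) => hle h)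
    (isUpperSet_openConnIn _ _ _) (measurableSet_mem _) (measurableSet_openConnIn _ _ _)).trans
    (measureReal_mono ?_)
  rintro ω ⟨h1, h2⟩
  exact mem_openConnIn_trans_of_subset
    (mem_openConnIn_of_mem_edge (Finset.mem_coe.2 hy) (Finset.mem_coe.2 hy') hadj h1) h2
    subset_rfl subset_rfl

/-- **Kozma–Nachmias 2011, Corollary 3.2, PROVED for the nearest-neighbour lattice `ℤ^d`** (`d ≥ 2`,
every `p ≥ p_c`): there are `c, C > 0` such that for all `r`, `s ≥ 1`, `x` with
`(x + Q_s) ∩ ∂Q_r ≠ ∅` and `y ∈ B = (x + Q_s) ∩ Q_r`,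
`P_p(y ↔ ∂Q_r in B) ≥ c e^{-C log² s}`. Here `B` is the finite set `{u ∈ Q_r : u - x ∈ Q_s}` and
`{y ↔ ∂Q_r in B}` the event that `y` is joined inside `B` to a site of the sphere `∂Q_r`.
[cite: KozmaNachmias2011, Cor. 3.2] -/
theorem KozmaNachmias2011_cor32 (hd : 2 ≤ d) (hp : criticalProb (zdGraph d) (0 : Site d) ≤ p) :
    ∃ c C : ℝ, 0 < c ∧ 0 < C ∧ ∀ r s : ℕ, 1 ≤ s → ∀ x : Site d,
      (∃ w ∈ sphere d r, w - x ∈ box d s) → ∀ y ∈ box d r, y - x ∈ box d s →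
        c * Real.exp (-C * Real.log s ^ 2) ≤ (bondPercolation (zdGraph d) p).real
          {ω | ∃ w ∈ sphere d r,
            ω ∈ openConnIn (↑((box d r).filter fun u => u - x ∈ box d s) : Set (Site d)) y w} := by
  classical
  have hd1 : 1 ≤ d := by omega
  obtain ⟨c₁, C₁, hc₁, hC₁, h11⟩ := KozmaNachmias2011_lemma11 hd p hp
  have hp0 : (0 : ℝ) < p := (criticalProb_zd_pos d hd1).trans_le hp
  have hp1 : (p : ℝ) ≤ 1 := p.2.2
  -- `c₁ ≤ 1`
  have hc₁1 : c₁ ≤ 1 := by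
    have h := h11 1 le_rfl 0 (zero_mem_box d 1)
    rw [Nat.cast_one, Real.log_one] at h
    simp only [ne_eq, OfNat.ofNat_ne_zero, not_false_eq_true, zero_pow, mul_zero, Real.exp_zero,
      mul_one] at h
    exact h.trans measureReal_le_one
  refine ⟨(p : ℝ) * c₁ ^ 2, 2 * C₁, by positivity, by positivity, fun r s hs x hw y hy hyx => ?_⟩
  set B : Finset (Site d) := (box d r).filter fun u => u - x ∈ box d s with hBdef
  have hmemB : ∀ u : Site d, u ∈ B ↔ u ∈ box d r ∧ u - x ∈ box d s := fun u => by
    rw [hBdef, Finset.mem_filter]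
  obtain ⟨h, z, w, y', hhs, hcube, hwS, hwz, hy'z, hyy', hy'box, hy'x⟩ := exists_cube hd1 hw hy hyx
  have hK : (zdShiftIso z) '' (↑(box d h) : Set (Site d)) ⊆ ↑B := by
    intro u hu
    rw [mem_image_zdShiftIso_box_iff] at hu
    exact Finset.mem_coe.2 ((hmemB u).2 (hcube u hu))
  -- the cube bound
  have htwo := real_openConnIn_two_points_ge p hc₁.le hc₁1 h11 hK hy'z hwz
  -- the exponent: `log² h ≤ log² s`
  have hexp : Real.exp (-(2 * C₁) * Real.log s ^ 2) ≤ (Real.exp (-C₁ * Real.log h ^ 2)) ^ 2 := by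
    rw [← Real.exp_nat_mul, Real.exp_le_exp]
    push_cast
    have hlog : Real.log h ^ 2 ≤ Real.log s ^ 2 := by
      rcases Nat.eq_zero_or_pos h with h0 | hpos
      · rw [h0, Nat.cast_zero, Real.log_zero, zero_pow two_ne_zero]; positivity
      · have h1 : 0 ≤ Real.log h := Real.log_nonneg (by exact_mod_cast hpos)
        have h2 : Real.log h ≤ Real.log s := Real.log_le_log (by exact_mod_cast hpos) (by exact_mod_cast hhs)
        exact pow_le_pow_left₀ h1 h2 2
    nlinarith
  have hmono : (bondPercolation (zdGraph d) p).real (openConnIn (↑B : Set (Site d)) y w) ≤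
      (bondPercolation (zdGraph d) p).real {ω | ∃ w ∈ sphere d r,
        ω ∈ openConnIn (↑B : Set (Site d)) y w} :=
    measureReal_mono fun ω hω => ⟨w, hwS, hω⟩
  refine le_trans ?_ hmono
  have hyB : y ∈ B := (hmemB y).2 ⟨hy, hyx⟩
  have hy'B : y' ∈ B := (hmemB y').2 ⟨hy'box, hy'x⟩
  rcases hyy' with rfl | hadj
  · calc (p : ℝ) * c₁ ^ 2 * Real.exp (-(2 * C₁) * Real.log s ^ 2)
        ≤ 1 * c₁ ^ 2 * (Real.exp (-C₁ * Real.log h ^ 2)) ^ 2 := by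
          gcongr
      _ = (c₁ * Real.exp (-C₁ * Real.log h ^ 2)) ^ 2 := by ring
      _ ≤ _ := htwo
  · calc (p : ℝ) * c₁ ^ 2 * Real.exp (-(2 * C₁) * Real.log s ^ 2)
        ≤ (p : ℝ) * (c₁ ^ 2 * (Real.exp (-C₁ * Real.log h ^ 2)) ^ 2) := by
          rw [mul_assoc]; gcongr
      _ = (p : ℝ) * (c₁ * Real.exp (-C₁ * Real.log h ^ 2)) ^ 2 := by ring
      _ ≤ (p : ℝ) * (bondPercolation (zdGraph d) p).real (openConnIn (↑B : Set (Site d)) y' w) :=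
          mul_le_mul_of_nonneg_left htwo hp0.le
      _ ≤ _ := real_openConnIn_ge_mul_of_adj p B hyB hy'B hadj

end Cor32

end Literature.Barriers.CriticalPhenomena

end
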